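import Mathlib
import Summits.NavierStokesRegularity.NavierStokesRegularity.Theorems.LerayQuarterDissipationFiniteDissipationLiouvilleWindowBlobSocket
import Summits.NavierStokesRegularity.NavierStokesRegularity.Theorems.LerayQuarterDissipationFiniteDissipationLiouvilleWindowCollar
import Summits.NavierStokesRegularity.NavierStokesRegularity.Theorems.LerayQuarterDissipationFiniteDissipationLiouvilleWindowRecurrenceStretching
import HarnessLib

/-!
# Crux `FiniteDissipationLiouville` (stmt-NavierStokesRegularity-22144): THE LAMB-FORM PRODUCTION EXCESS
# FILLS A PARABOLIC CYLINDER OF DEFINITE RELATIVE SIZE IN EVERY WINDOW (blob, with a margin)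

Theorems file of route `LerayQuarterDissipation` (lead prover g19; `--supports` the crux; first instance of
`…WindowBlobSocket`, using the uniform 2-jet convergence of `…CompactnessJets`). Navier–Stokes regularity
is NOT proved by anything here; no summit is.

* **`jet_tendsto_prod`** — «continuous convergence of the 2-jet»: along a `seqLimit₂`-convergent sequence
  `u_j → W` and at a point `(t₀, x₀)` of the open past there is a neighbourhood `s` (a slab piece) such
  that `u_j(q) → W(p₀)`, `curl u_j(q) → curl W(p₀)`, `curl curl u_j(q) → curl curl W(p₀)`,
  `∇u_j(q) → ∇W(p₀)`, `∇curl u_j(q) → ∇curl W(p₀)` and `q.1 → t₀` as `(j, q) → (∞, p₀)` JOINTLY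
  (uniform convergence on the piece + joint continuity of the jet of `W`);
* `localBalance_factor_ball` — the BALL TRANSFER for the Lamb-form balance with factors `θ_j → 1`: a
  violation of the balance by the limit at `(t₀,x₀)` gives a ball on which all late approximants violate
  the balance with factor `θ_j`;
* **`localBalance_excess_blob`** / **`localBalance_excess_blob_in_every_window`** — for every `A` there are
  `ε(A) ∈ (0,1)`, `ρ(A) > 0`, `δ(A) > 0` such that every SINGULAR KNSS-gauge Type-I field
  (`IsTypeIAncientMild C V`, `C ≤ A`) with a Type-I envelope `HasTypeIDecay A V` contains, in EVERY
  window `[−c², −εc²]`, a whole parabolic cylinder `[t₀ − (ρc)², t₀] × B(x₀, ρc)` on which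
  `(1+δ)(‖curl ω‖² + ‖ω‖²/(4(−t))) < ⟪u, ω × curl ω⟫`: **the region where Lamb-form enstrophy production
  beats local dissipation plus the scaling quarter BY A DEFINITE FACTOR is not filamentary — it contains
  a coherent parabolic blob of definite relative size at every scale** (hence so do the product-bound,
  cross-flow and speed violation sets, which contain it pointwise).

HONEST FRAMING. Compactness corollary (ineffective `ε, ρ, δ`) about a HYPOTHETICAL singular enveloped
profile; nothing is removed from the DSS wall (`∀ c>1 TypeIDSSLiouville c`, NECESSARY for the crux).
Nothing here bears on NS regularity.

References: Koch–Nadirashvili–Seregin–Šverák, Acta Math. 203 (2009) §4; folklore.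
-/

noncomputable section

set_option linter.dupNamespace false

namespace Summit.NavierStokesRegularity.NavierStokesRegularity.Theorems.FiniteDissipationLiouville.WindowRecurrence

open MeasureTheory Set Filter Topology Metric InnerProductSpace Function Real
open scoped RealInnerProductSpace ContDiff ENNReal
open Literature.Analysis Literature.Analysis.FluidPDE
open Summit.NavierStokesRegularity.NavierStokesRegularity.Theorems
open Summit.NavierStokesRegularity.NavierStokesRegularity.Theorems.RecurrentReductionD
open Summit.NavierStokesRegularity.NavierStokesRegularity.Theorems.FiniteDissipationLiouville
open Summit.NavierStokesRegularity.NavierStokesRegularity.Theorems.FiniteDissipationLiouville.CrossFlow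
open Summit.NavierStokesRegularity.NavierStokesRegularity.Theorems.FiniteDissipationLiouville.LocalBalance
open Summit.NavierStokesRegularity.NavierStokesRegularity.Theorems.FiniteDissipationLiouville.WindowSocket
open Summit.NavierStokesRegularity.NavierStokesRegularity.Theorems.FiniteDissipationLiouville.Compactness

variable {C : ℝ}

/-! ### Continuous convergence of the 2-jet -/

section Jet

/-- **Continuous convergence of the 2-jet along a `seqLimit₂`-convergent sequence.** See the module
docstring. [cite: KochNadirashviliSereginSverak2009, Prop. 4.1 (arXiv:0709.3599 p. 8)] -/
theorem jet_tendsto_prod {v : ℕ → ℝ → EuclideanSpace ℝ (Fin 3) → EuclideanSpace ℝ (Fin 3)}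
    {W : ℝ → EuclideanSpace ℝ (Fin 3) → EuclideanSpace ℝ (Fin 3)}
    (hv : ∀ j, IsTypeIAncientMild C (v j)) (hW : IsTypeIAncientMild C W)
    (hunif : ∀ n : ℕ, TendstoUniformlyOn (fun j z => v j z.1 z.2) (fun z => W z.1 z.2) atTop
      (Icc (-((n : ℝ) + 2)) (-(1 / ((n : ℝ) + 2))) ×ˢ
        closedBall (0 : EuclideanSpace ℝ (Fin 3)) ((n : ℝ) + 2)))
    (hunifG : ∀ n : ℕ, TendstoUniformlyOn (fun j z => fderiv ℝ (v j z.1) z.2) (fun z => fderiv ℝ (W z.1) z.2)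
      atTop (Icc (-((n : ℝ) + 2)) (-(1 / ((n : ℝ) + 2))) ×ˢ
        closedBall (0 : EuclideanSpace ℝ (Fin 3)) ((n : ℝ) + 2)))
    (hunifH : ∀ n : ℕ, TendstoUniformlyOn (fun j z => fderiv ℝ (fderiv ℝ (v j z.1)) z.2)
      (fun z => fderiv ℝ (fderiv ℝ (W z.1)) z.2)
      atTop (Icc (-((n : ℝ) + 2)) (-(1 / ((n : ℝ) + 2))) ×ˢ
        closedBall (0 : EuclideanSpace ℝ (Fin 3)) ((n : ℝ) + 2)))
    {t₀ : ℝ} (ht₀ : t₀ < 0) (x₀ : EuclideanSpace ℝ (Fin 3)) :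
    ∃ s : Set (ℝ × EuclideanSpace ℝ (Fin 3)), s ∈ 𝓝 ((t₀, x₀) : ℝ × EuclideanSpace ℝ (Fin 3)) ∧
      Tendsto (fun q : ℕ × (ℝ × EuclideanSpace ℝ (Fin 3)) => q.2.1) (atTop ×ˢ 𝓝[s] (t₀, x₀)) (𝓝 t₀) ∧
      Tendsto (fun q : ℕ × (ℝ × EuclideanSpace ℝ (Fin 3)) => v q.1 q.2.1 q.2.2)
        (atTop ×ˢ 𝓝[s] (t₀, x₀)) (𝓝 (W t₀ x₀)) ∧
      Tendsto (fun q : ℕ × (ℝ × EuclideanSpace ℝ (Fin 3)) => curl (v q.1 q.2.1) q.2.2)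
        (atTop ×ˢ 𝓝[s] (t₀, x₀)) (𝓝 (curl (W t₀) x₀)) ∧
      Tendsto (fun q : ℕ × (ℝ × EuclideanSpace ℝ (Fin 3)) => curl (curl (v q.1 q.2.1)) q.2.2)
        (atTop ×ˢ 𝓝[s] (t₀, x₀)) (𝓝 (curl (curl (W t₀)) x₀)) ∧
      Tendsto (fun q : ℕ × (ℝ × EuclideanSpace ℝ (Fin 3)) => fderiv ℝ (v q.1 q.2.1) q.2.2)
        (atTop ×ˢ 𝓝[s] (t₀, x₀)) (𝓝 (fderiv ℝ (W t₀) x₀)) ∧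
      Tendsto (fun q : ℕ × (ℝ × EuclideanSpace ℝ (Fin 3)) => fderiv ℝ (curl (v q.1 q.2.1)) q.2.2)
        (atTop ×ˢ 𝓝[s] (t₀, x₀)) (𝓝 (fderiv ℝ (curl (W t₀)) x₀)) := by
  obtain ⟨n, hn⟩ := (eventually_slabPiece_mem_nhds (E := EuclideanSpace ℝ (Fin 3)) ht₀ x₀).exists
  set s : Set (ℝ × EuclideanSpace ℝ (Fin 3)) := Icc (-((n : ℝ) + 2)) (-(1 / ((n : ℝ) + 2))) ×ˢ
    closedBall (0 : EuclideanSpace ℝ (Fin 3)) ((n : ℝ) + 2) with hs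
  have hp₀ : ((t₀, x₀) : ℝ × EuclideanSpace ℝ (Fin 3)) ∈ s := mem_of_mem_nhds hn
  have hsub : s ⊆ Iio (0 : ℝ) ×ˢ (univ : Set (EuclideanSpace ℝ (Fin 3))) :=
    fun z hz => ⟨neg_of_mem_slabPiece hz, mem_univ _⟩
  -- uniform convergence of the derived jets on the piece
  have hcurl := tendstoUniformlyOn_curl_of_fderiv (hunifG n)
  have hfcurl := tendstoUniformlyOn_fderiv_curl_of_hessian hv hW (fun z hz => neg_of_mem_slabPiece hz) (hunifH n)
  have hcurlcurl := tendstoUniformlyOn_curl_of_fderiv (v := fun j t => curl (v j t)) (W := fun t => curl (W t)) hfcurl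
  -- continuity of the jet of `W` within the piece
  have c0 := ((continuousOn_val hW).mono hsub).continuousWithinAt hp₀
  have c1 := ((continuousOn_curl hW).mono hsub).continuousWithinAt hp₀
  have c2 := ((continuousOn_curl_curl hW).mono hsub).continuousWithinAt hp₀
  have c3 := ((continuousOn_fderiv hW).mono hsub).continuousWithinAt hp₀
  have c4 := ((continuousOn_fderiv_curl hW).mono hsub).continuousWithinAt hp₀
  refine ⟨s, hn, ?_, ?_, ?_, ?_, ?_, ?_⟩
  · have h1 : Tendsto (fun q : ℕ × (ℝ × EuclideanSpace ℝ (Fin 3)) => q.2) (atTop ×ˢ 𝓝[s] (t₀, x₀))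
        (𝓝 (t₀, x₀)) := tendsto_snd.mono_right nhdsWithin_le_nhds
    exact (continuous_fst.tendsto _).comp h1
  · exact tendsto_prod_nhdsWithin_of_tendstoUniformlyOn (hunif n) c0
  · exact tendsto_prod_nhdsWithin_of_tendstoUniformlyOn hcurl c1
  · exact tendsto_prod_nhdsWithin_of_tendstoUniformlyOn hcurlcurl c2
  · exact tendsto_prod_nhdsWithin_of_tendstoUniformlyOn (hunifG n) c3
  · exact tendsto_prod_nhdsWithin_of_tendstoUniformlyOn hfcurl c4

end Jet

/-! ### The Lamb-form balance: ball transfer and blobs -/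

section Lamb

/-- **Ball transfer for the Lamb-form balance with factors `θ_j → 1`.** [cite: KochNadirashviliSereginSverak2009, Prop. 4.1 (arXiv:0709.3599 p. 8)] -/
theorem localBalance_factor_ball {v : ℕ → ℝ → EuclideanSpace ℝ (Fin 3) → EuclideanSpace ℝ (Fin 3)}
    {W : ℝ → EuclideanSpace ℝ (Fin 3) → EuclideanSpace ℝ (Fin 3)} {θ : ℕ → ℝ}
    (hv : ∀ j, IsTypeIAncientMild C (v j)) (hW : IsTypeIAncientMild C W)
    (hunif : ∀ n : ℕ, TendstoUniformlyOn (fun j z => v j z.1 z.2) (fun z => W z.1 z.2) atTop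
      (Icc (-((n : ℝ) + 2)) (-(1 / ((n : ℝ) + 2))) ×ˢ
        closedBall (0 : EuclideanSpace ℝ (Fin 3)) ((n : ℝ) + 2)))
    (hunifG : ∀ n : ℕ, TendstoUniformlyOn (fun j z => fderiv ℝ (v j z.1) z.2) (fun z => fderiv ℝ (W z.1) z.2)
      atTop (Icc (-((n : ℝ) + 2)) (-(1 / ((n : ℝ) + 2))) ×ˢ
        closedBall (0 : EuclideanSpace ℝ (Fin 3)) ((n : ℝ) + 2)))
    (hunifH : ∀ n : ℕ, TendstoUniformlyOn (fun j z => fderiv ℝ (fderiv ℝ (v j z.1)) z.2)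
      (fun z => fderiv ℝ (fderiv ℝ (W z.1)) z.2)
      atTop (Icc (-((n : ℝ) + 2)) (-(1 / ((n : ℝ) + 2))) ×ˢ
        closedBall (0 : EuclideanSpace ℝ (Fin 3)) ((n : ℝ) + 2)))
    (hθ : Tendsto θ atTop (𝓝 1)) {t₀ : ℝ} (ht₀ : t₀ < 0) (x₀ : EuclideanSpace ℝ (Fin 3))
    (hbad : ¬ ⟪W t₀ x₀, cross (curl (W t₀) x₀) (curl (curl (W t₀)) x₀)⟫ ≤
      1 * (‖curl (curl (W t₀)) x₀‖ ^ 2 + ‖curl (W t₀) x₀‖ ^ 2 / (4 * (-t₀)))) :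
    ∃ r : ℝ, 0 < r ∧ ∀ᶠ j in atTop, ∀ q : ℝ × EuclideanSpace ℝ (Fin 3), dist q (t₀, x₀) < r →
      ¬ ⟪v j q.1 q.2, cross (curl (v j q.1) q.2) (curl (curl (v j q.1)) q.2)⟫ ≤
        θ j * (‖curl (curl (v j q.1)) q.2‖ ^ 2 + ‖curl (v j q.1) q.2‖ ^ 2 / (4 * (-q.1))) := by
  obtain ⟨s, hs, hT, h0, h1, h2, -, -⟩ := jet_tendsto_prod hv hW hunif hunifG hunifH ht₀ x₀
  -- the read-outs along `(j, q) → (∞, p₀)`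
  have hcr : Tendsto (fun q : ℕ × (ℝ × EuclideanSpace ℝ (Fin 3)) =>
      cross (curl (v q.1 q.2.1) q.2.2) (curl (curl (v q.1 q.2.1)) q.2.2))
      (atTop ×ˢ 𝓝[s] (t₀, x₀)) (𝓝 (cross (curl (W t₀) x₀) (curl (curl (W t₀)) x₀))) := by
    have h := ((crossCLM.continuous₂).tendsto (curl (W t₀) x₀, curl (curl (W t₀)) x₀)).comp
      (h1.prodMk_nhds h2)
    refine h.congr fun q => ?_
    simp [Function.comp, crossCLM_apply]
  have hL : Tendsto (fun q : ℕ × (ℝ × EuclideanSpace ℝ (Fin 3)) =>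
      ⟪v q.1 q.2.1 q.2.2, cross (curl (v q.1 q.2.1) q.2.2) (curl (curl (v q.1 q.2.1)) q.2.2)⟫)
      (atTop ×ˢ 𝓝[s] (t₀, x₀))
      (𝓝 ⟪W t₀ x₀, cross (curl (W t₀) x₀) (curl (curl (W t₀)) x₀)⟫) := h0.inner hcr
  have hθ' : Tendsto (fun q : ℕ × (ℝ × EuclideanSpace ℝ (Fin 3)) => θ q.1) (atTop ×ˢ 𝓝[s] (t₀, x₀)) (𝓝 1) :=
    hθ.comp tendsto_fst
  have hden : Tendsto (fun q : ℕ × (ℝ × EuclideanSpace ℝ (Fin 3)) => 4 * (-q.2.1))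
      (atTop ×ˢ 𝓝[s] (t₀, x₀)) (𝓝 (4 * (-t₀))) := (hT.neg).const_mul 4
  have hden0 : (4 : ℝ) * (-t₀) ≠ 0 := by
    have : 0 < -t₀ := neg_pos.2 ht₀
    positivity
  have hR : Tendsto (fun q : ℕ × (ℝ × EuclideanSpace ℝ (Fin 3)) =>
      θ q.1 * (‖curl (curl (v q.1 q.2.1)) q.2.2‖ ^ 2 + ‖curl (v q.1 q.2.1) q.2.2‖ ^ 2 / (4 * (-q.2.1))))
      (atTop ×ˢ 𝓝[s] (t₀, x₀))
      (𝓝 (1 * (‖curl (curl (W t₀)) x₀‖ ^ 2 + ‖curl (W t₀) x₀‖ ^ 2 / (4 * (-t₀))))) :=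
    hθ'.mul ((h2.norm.pow 2).add ((h1.norm.pow 2).div hden hden0))
  rw [not_le] at hbad
  have hev := hR.eventually_lt hL hbad
  obtain ⟨r, hr, hball⟩ := exists_ball_eventually_of_prod_nhds hs hev
  refine ⟨r, hr, hball.mono fun j hj q hq => ?_⟩
  have := hj q hq
  exact not_le.2 this

/-- **THE LAMB-FORM PRODUCTION EXCESS BY A FACTOR FILLS A BLOB IN THE UNIT WINDOW.**
[folklore compactness; cite: KochNadirashviliSereginSverak2009, §4 (arXiv:0709.3599 p. 8)] -/
theorem localBalance_excess_blob (A : ℝ) : ∃ ε : ℝ, 0 < ε ∧ ε < 1 ∧ ∃ ρ : ℝ, 0 < ρ ∧ ∃ δ : ℝ, 0 < δ ∧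
    ∀ (C : ℝ) (V : ℝ → EuclideanSpace ℝ (Fin 3) → EuclideanSpace ℝ (Fin 3)),
      IsTypeIAncientMild C V → C ≤ A → HasTypeIDecay A V →
      (∀ r > 0, ∀ M : ℝ, ∃ t ∈ Ioo (-(r ^ 2)) (0 : ℝ),
        ∃ x ∈ ball (0 : EuclideanSpace ℝ (Fin 3)) r, M < ‖V t x‖) →
      ∃ (t₀ : ℝ) (x₀ : EuclideanSpace ℝ (Fin 3)), Icc (t₀ - ρ ^ 2) t₀ ⊆ Icc (-1 : ℝ) (-ε) ∧
        ∀ t ∈ Icc (t₀ - ρ ^ 2) t₀, ∀ x ∈ ball x₀ ρ,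
          (1 + δ) * (‖curl (curl (V t)) x‖ ^ 2 + ‖curl (V t) x‖ ^ 2 / (4 * (-t))) <
            ⟪V t x, cross (curl (V t) x) (curl (curl (V t)) x)⟫ := by
  obtain ⟨ε, hε, hε1, ρ, hρ, δ, hδ, h⟩ := exists_blob_margin_of_apex_kill_envelope (C := A) (θ₀ := 1)
    (G := fun θ F t x => ⟪F t x, cross (curl (F t) x) (curl (curl (F t)) x)⟫ ≤
      θ * (‖curl (curl (F t)) x‖ ^ 2 + ‖curl (F t) x‖ ^ 2 / (4 * (-t))))
    (fun u W θ hu hW hunif hunifG hunifH hθ t₀ ht₀ x₀ hbad =>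
      localBalance_factor_ball hu hW hunif hunifG hunifH hθ ht₀ x₀ hbad)
    (fun W hW hdW hG => not_singular_of_localBalance_near_apex hW hdW (τ := -1/2) (by norm_num)
      fun t h1 h2 x => by have := hG t (by linarith) h2 x; rwa [one_mul] at this)
  refine ⟨ε, hε, hε1, ρ, hρ, δ, hδ, fun C V hV hCA hdec hsing => ?_⟩
  obtain ⟨t₀, x₀, hwin, hblob⟩ := h V (isTypeIAncientMild_of_le hV hCA) hdec hsing
  exact ⟨t₀, x₀, hwin, fun t ht x hx => not_le.1 (hblob t ht x hx)⟩

/-- **THE LAMB-FORM PRODUCTION EXCESS BY A FACTOR FILLS A PARABOLIC CYLINDER OF DEFINITE RELATIVE SIZE IN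
EVERY WINDOW.** For every `A`: `ε(A) ∈ (0,1)`, `ρ(A), δ(A) > 0` such that every singular enveloped member
has, in every window `[−c², −εc²]`, a cylinder `[t₀ − (ρc)², t₀] × B(x₀, ρc)` on which
`(1+δ)(‖curl ω‖² + ‖ω‖²/(4(−t))) < ⟪u, ω × curl ω⟫`.
[folklore compactness; cite: KochNadirashviliSereginSverak2009, §4 (arXiv:0709.3599 p. 8)] -/
theorem localBalance_excess_blob_in_every_window (A : ℝ) : ∃ ε : ℝ, 0 < ε ∧ ε < 1 ∧ ∃ ρ : ℝ, 0 < ρ ∧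
    ∃ δ : ℝ, 0 < δ ∧
    ∀ (C : ℝ) (V : ℝ → EuclideanSpace ℝ (Fin 3) → EuclideanSpace ℝ (Fin 3)),
      IsTypeIAncientMild C V → C ≤ A → HasTypeIDecay A V →
      (∀ r > 0, ∀ M : ℝ, ∃ t ∈ Ioo (-(r ^ 2)) (0 : ℝ),
        ∃ x ∈ ball (0 : EuclideanSpace ℝ (Fin 3)) r, M < ‖V t x‖) →
      ∀ c : ℝ, 0 < c → ∃ (t₀ : ℝ) (x₀ : EuclideanSpace ℝ (Fin 3)),
        Icc (t₀ - (ρ * c) ^ 2) t₀ ⊆ Icc (-c ^ 2) (-(ε * c ^ 2)) ∧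
        ∀ t ∈ Icc (t₀ - (ρ * c) ^ 2) t₀, ∀ x ∈ ball x₀ (ρ * c),
          (1 + δ) * (‖curl (curl (V t)) x‖ ^ 2 + ‖curl (V t) x‖ ^ 2 / (4 * (-t))) <
            ⟪V t x, cross (curl (V t) x) (curl (curl (V t)) x)⟫ := by
  obtain ⟨ε, hε, hε1, ρ, hρ, δ, hδ, h⟩ := localBalance_excess_blob A
  refine ⟨ε, hε, hε1, ρ, hρ, δ, hδ, fun C V hV hCA hdec hsing c hc => ?_⟩
  obtain ⟨t₀, x₀, hwin, hblob⟩ := h C (nsRescale c V) (hV.nsRescale hc) hCA (hdec.nsRescale hc)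
    (singularAtOrigin_nsRescale hsing hc)
  obtain ⟨hwin', hblob'⟩ := blob_rescale (θ := 1 + δ) (ε := ε) (ρ := ρ) (c := c)
    (G := fun θ F t x => ⟪F t x, cross (curl (F t) x) (curl (curl (F t)) x)⟫ ≤
      θ * (‖curl (curl (F t)) x‖ ^ 2 + ‖curl (F t) x‖ ^ 2 / (4 * (-t))))
    (fun F c' t x hc' ht hG => localBalance_factor_at_nsRescale (1 + δ) F x hc' ht hG) hc hε hwin
    (fun t ht x hx => not_le.2 (hblob t ht x hx))
  exact ⟨c ^ 2 * t₀, c • x₀, hwin', fun t ht x hx => not_le.1 (hblob' t ht x hx)⟩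

end Lamb

end Summit.NavierStokesRegularity.NavierStokesRegularity.Theorems.FiniteDissipationLiouville.WindowRecurrence

end
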